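import Literature.Topology.FourManifolds.CodimTwoLinkingHomomorphism
import Literature.Topology.FourManifolds.SeifertCircleMapProofs
import Literature.Topology.FourManifolds.CircleMapRegularValues
import Literature.Analysis.Calculus.SardProofs
import HarnessLib

/-!
# The circle-valued map of the complement of a framed codimension-two submanifold with simply
# connected core; existence of Seifert hypersurface data (Kirby 1989, VIII Thm. 3, analytic half)

Topic `Literature/Topology/FourManifolds`; fact seat
`provefact-Literature.Topology.FourManifolds.isOrientedBordant_of_isEmpty_of_signature_eq_zero`
(Kirby, *The Topology of 4-Manifolds* (1989), Cor. IX.2 via VIII Thm 1(A) and VIII Thm 3).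
Kirby's proof of VIII **Thm 3** (p. 45): *"`α` is represented by `f_α : Q − N → S¹` with
`f_α = pν` on `∂Y` … make `f_α` transverse to a point `p ∈ S¹`"*.  Here, for `Q = Sⁿ⁺²`, `n ≥ 1`
and a connected, simply connected compact core `M` with a framed tubular neighbourhood `E`
(`Literature.Topology.FourManifolds.FramedTubularEmbedding n 2 M`):

* `FramedTubularEmbedding.exists_circleMap_eq_angle` — **there is a `C^∞` map
  `θ : Sⁿ⁺² ∖ M → 𝕊¹` which on the punctured closed unit tube is the fibre angle**,
  `θ (tube (x, w)) = w/‖w‖` for `0 < ‖w‖ ≤ 1`;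
* `FramedTubularEmbedding.nonempty_seifertHypersurfaceDatum` — **Seifert hypersurface data exist**
  (`SeifertHypersurfaceLevel.lean`): such a `θ` together with a regular value `v` whose antipode is
  regular too (Brown–Sard, the tree's `exists_circlePt_isRegularValue_and_antipode` with
  `sard_holds`).

The construction ports the tree's knot case (`SeifertCircleMapProofs.lean`, Juhász 2023 proof
of Prop. 4.10, steps 2–4) to every dimension, the winding homomorphism of step 1 being the linking
homomorphism `φ : π₁(Sⁿ⁺² ∖ M, p₀) → ℤ`, `φ [meridian] = 1`, of
`CodimTwoLinkingHomomorphism.lean`: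

2. **`f_α`** (`exists_contMDiff_circleMap_realising`, Hatcher Prop. 1B.9 in smooth form): a `C^∞`
   map `Θ : Sⁿ⁺² ∖ M → 𝕊¹` whose winding along every loop at `p₀` is `φ`.
3. **Agreement with the fibre angle**: on the cover `P : M × ℝ × ℝ → punctured tube`,
   `P (x, s, r) = tube (x, eʳ e^{is})` — simply connected because `M` is — `Θ ∘ P` lifts to a
   continuous (hence smooth) `H` (Mathlib `IsCoveringMap.existsUnique_continuousMap_lifts` for
   `circlePoint`); its increment under the deck translation `s ↦ s + 2π` is continuous with values
   in `2πℤ`, hence constant, equal to the winding of `Θ` along the meridian, `2πφ [μ] = 2π`; so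
   `G = (H - s)/2π` is deck invariant and descends to a smooth `g` on the punctured tube with
   `e^{i(arg Θ - 2πg)} =` fibre angle.  (No longitude condition arises: the only deck
   transformations are the `s`-translations, `M` being simply connected.)
4. **Cut-off**: `θ = e^{i(arg Θ - 2πχg)}` with `χ = 1` on the closed unit tube and `χ = 0` off
   the tube of radius `3/2`.

Everything here is **proved**; no named fact is introduced.

## References

* R. C. Kirby, *The Topology of 4-Manifolds*, LNM 1374 (1989), Ch. VIII, proof of Thm. 3
  (p. 45). [Kirby1989]
* A. Juhász, *Differential and Low-Dimensional Topology* (2023), proof of Prop. 4.10.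
  [Juhasz2023]
* A. Hatcher, *Algebraic Topology* (2002), Prop. 1B.9, Prop. 1.30–1.33. [HatcherAT2002]
* J. Milnor, *Topology from the Differentiable Viewpoint* (1965), §3 (Brown–Sard).
  [MilnorTDV1965]
-/

noncomputable section

open Set Function Filter
open scoped Manifold ContDiff Topology unitInterval Real

namespace Literature.Topology.FourManifolds

/-- Local notation: `𝔼 n` is the model Euclidean space `EuclideanSpace ℝ (Fin n)`. -/
local notation "𝔼 " n:arg => EuclideanSpace ℝ (Fin n)

/-- Local notation: `𝕊 n` is the unit sphere in `EuclideanSpace ℝ (Fin (n + 1))`. -/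
local notation "𝕊 " n:arg => (Metric.sphere (0 : EuclideanSpace ℝ (Fin (n + 1))) 1)

/-- Local notation for the homotopy class of a path (Mathlib's `Path.Homotopic.Quotient.mk`). -/
local notation "⟦" p "⟧ₚ" => Path.Homotopic.Quotient.mk p

-- `Fact (finrank ℝ ℝᵐ⁺¹ = m + 1)`, under which Mathlib charts the round spheres on `ℝᵐ`.
attribute [local instance] fact_finrank_euclideanSpace_succ

/-! ### The cover `M × ℝ × ℝ → M × (ℝ² ∖ 0)` of the punctured tube coordinates -/

namespace CodimTwo

variable {M : Type}

/-- The covering map `M × ℝ × ℝ → M × (ℝ² ∖ 0)`, `(x, s, r) ↦ (x, eʳ e^{is})` (fibre angle,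
logarithmic fibre radius; at `(x, 0, 0)` it is `(x, e₀)`). [folklore] -/
def cover (m : M × ℝ × ℝ) : M × 𝔼 2 :=
  (m.1, Real.exp m.2.2 • ((circlePoint m.2.1 : 𝕊 1) : 𝔼 2))

/-- The fibre coordinate of the cover is nonzero. [folklore] -/
theorem cover_snd_ne_zero (m : M × ℝ × ℝ) : (cover m).2 ≠ 0 :=
  smul_ne_zero (Real.exp_pos _).ne' (ne_zero_of_mem_unit_sphere _)

/-- The norm of the fibre coordinate of the cover is `eʳ`. [folklore] -/
theorem norm_cover_snd (m : M × ℝ × ℝ) : ‖(cover m).2‖ = Real.exp m.2.2 := by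
  rw [cover, norm_smul, norm_eq_of_mem_sphere, mul_one, Real.norm_eq_abs,
    abs_of_pos (Real.exp_pos _)]

/-- The first coordinate of the cover. [folklore] -/
@[simp] theorem cover_fst (m : M × ℝ × ℝ) : (cover m).1 = m.1 := rfl

/-- The deck translation `s ↦ s + 2π`. [folklore] -/
def shiftS (m : M × ℝ × ℝ) : M × ℝ × ℝ := (m.1, m.2.1 + 2 * π, m.2.2)

/-- Value of the deck translation. [folklore] -/
@[simp] theorem shiftS_apply (x : M) (s r : ℝ) : shiftS (x, s, r) = (x, s + 2 * π, r) := rfl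

/-- Deck invariance of the cover. [folklore] -/
theorem cover_shiftS (m : M × ℝ × ℝ) : cover (shiftS m) = cover m := by
  obtain ⟨x, s, r⟩ := m
  simp only [cover, shiftS_apply, circlePoint_add_two_pi]

/-- **Fibres of the cover are orbits of the deck group `2πℤ` acting on `s`.** [folklore] -/
theorem exists_int_of_cover_eq {m m' : M × ℝ × ℝ} (h : cover m = cover m') :
    ∃ l : ℤ, m'.1 = m.1 ∧ m'.2.1 = m.2.1 + l * (2 * π) ∧ m'.2.2 = m.2.2 := by
  obtain ⟨h1, h2⟩ := Prod.ext_iff.1 h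
  simp only [cover] at h1 h2
  -- radii
  have hr : m'.2.2 = m.2.2 := by
    have hn := congrArg (fun w : 𝔼 2 => ‖w‖) h2
    simp only [norm_smul, norm_eq_of_mem_sphere, mul_one, Real.norm_eq_abs,
      abs_of_pos (Real.exp_pos _)] at hn
    exact Real.exp_injective hn.symm
  -- fibre angles
  rw [hr] at h2
  have h2' : circlePoint m.2.1 = circlePoint m'.2.1 :=
    Subtype.ext (smul_right_injective (𝔼 2) (Real.exp_pos _).ne' h2)
  obtain ⟨l, hl⟩ := exists_eq_add_of_circlePoint_eq h2'.symm
  exact ⟨l, h1.symm, hl, hr⟩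

/-- The cover at `(x, 0, 0)` is `(x, e₀)`. [folklore] -/
theorem cover_base (x : M) :
    cover ((x, 0, 0) : M × ℝ × ℝ) = (x, ((circlePoint 0 : 𝕊 1) : 𝔼 2)) := by
  simp [cover]

/-- A fixed (discontinuous) global section of the cover over `M × (ℝ² ∖ 0)`: the first plane
angle of `w` and `log ‖w‖`. [folklore] -/
def sec₀ (p : M × 𝔼 2) : M × ℝ × ℝ := (p.1, argE p.2, Real.log ‖p.2‖)

/-- The global section is a section off the zero section. [folklore] -/
theorem cover_sec₀ (x : M) {w : 𝔼 2} (hw : w ≠ 0) : cover (sec₀ (x, w)) = (x, w) := by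
  have hn : 0 < ‖w‖ := norm_pos_iff.2 hw
  show (x, Real.exp (Real.log ‖w‖) • ((circlePoint (argE w) : 𝕊 1) : 𝔼 2)) = (x, w)
  rw [Real.exp_log hn, coe_circlePoint_argE hw, smul_smul, mul_inv_cancel₀ hn.ne', one_smul]

section Topology

variable [TopologicalSpace M]

/-- The cover is smooth (`M` a charted space). [folklore] -/
theorem contMDiff_cover {n : ℕ} [ChartedSpace (𝔼 n) M] :
    ContMDiff ((𝓡 n).prod 𝓘(ℝ, ℝ × ℝ)) ((𝓡 n).prod 𝓘(ℝ, 𝔼 2)) ∞ (cover (M := M)) := by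
  haveI : Fact (Module.finrank ℝ (𝔼 2) = 1 + 1) := ⟨by simp⟩
  refine contMDiff_fst.prodMk ?_
  have h1 : ContMDiff 𝓘(ℝ, ℝ × ℝ) 𝓘(ℝ, ℝ) ∞ fun v : ℝ × ℝ => Real.exp v.2 :=
    (Real.contDiff_exp.comp contDiff_snd).contMDiff
  have h2 : ContMDiff 𝓘(ℝ, ℝ × ℝ) 𝓘(ℝ, 𝔼 2) ∞ fun v : ℝ × ℝ => ((circlePoint v.1 : 𝕊 1) : 𝔼 2) :=
    contMDiff_coe_sphere.comp (contMDiff_circlePoint.comp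
      (contDiff_fst : ContDiff ℝ ∞ fun v : ℝ × ℝ => v.1).contMDiff)
  exact (h1.smul h2).comp contMDiff_snd

/-- The cover is continuous. [folklore] -/
theorem continuous_cover : Continuous (cover (M := M)) := by
  refine continuous_fst.prodMk ?_
  exact ((Real.continuous_exp.comp (continuous_snd.comp continuous_snd)).smul
    (continuous_subtype_val.comp (continuous_circlePoint.comp
      (continuous_fst.comp continuous_snd))))

/-- The deck translation is continuous. [folklore] -/
theorem continuous_shiftS : Continuous (shiftS (M := M)) :=
  continuous_fst.prodMk (((continuous_fst.comp continuous_snd).add continuous_const).prodMk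
    (continuous_snd.comp continuous_snd))

/-- The straight segment `u ↦ (x, 2πu, 0)` from `(x, 0, 0)` to `(x, 2π, 0)`. [folklore] -/
def segS (x : M) : Path ((x, 0, 0) : M × ℝ × ℝ) (x, 2 * π, 0) where
  toFun u := (x, 2 * π * u, 0)
  continuous_toFun := by fun_prop
  source' := by simp
  target' := by simp

/-- Values of the straight segment. [folklore] -/
@[simp] theorem segS_apply (x : M) (u : I) : segS x u = (x, 2 * π * u, 0) := rfl

/-- **Smooth local sections of the cover**: near any `(x₀, w₀)` with `w₀ ≠ 0` there is a map
`sc : M × ℝ² → M × ℝ × ℝ`, smooth at `(x₀, w₀)`, with `cover (sc (x, w)) = (x, w)` for all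
`w ≠ 0` (a plane angle of `w` and `log ‖w‖`). [folklore] -/
theorem exists_localSection {n : ℕ} [ChartedSpace (𝔼 n) M] (x₀ : M) {w₀ : 𝔼 2} (hw₀ : w₀ ≠ 0) :
    ∃ sc : M × 𝔼 2 → M × ℝ × ℝ,
      ContMDiffAt ((𝓡 n).prod 𝓘(ℝ, 𝔼 2)) ((𝓡 n).prod 𝓘(ℝ, ℝ × ℝ)) ∞ sc (x₀, w₀) ∧
      ∀ (x : M) (w : 𝔼 2), w ≠ 0 → cover (sc (x, w)) = (x, w) := by
  obtain ⟨A, hA, hAs⟩ := exists_planeAngle_contDiffAt hw₀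
  refine ⟨fun p => (p.1, A p.2, Real.log ‖p.2‖), ?_, fun x w hw => ?_⟩
  · refine contMDiffAt_fst.prodMk ?_
    have h3 : ContDiffAt ℝ ∞ (fun w : 𝔼 2 => Real.log ‖w‖) w₀ :=
      (contDiffAt_norm ℝ hw₀).log (norm_ne_zero_iff.2 hw₀)
    exact ((hA.prodMk h3).contMDiffAt).comp (x₀, w₀)
      (contMDiffAt_snd : ContMDiffAt ((𝓡 n).prod 𝓘(ℝ, 𝔼 2)) 𝓘(ℝ, 𝔼 2) ∞
        (Prod.snd : M × 𝔼 2 → 𝔼 2) (x₀, w₀))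
  · have hn : 0 < ‖w‖ := norm_pos_iff.2 hw
    show (x, Real.exp (Real.log ‖w‖) • ((circlePoint (A w) : 𝕊 1) : 𝔼 2)) = (x, w)
    rw [Real.exp_log hn, hAs w hw, smul_smul, mul_inv_cancel₀ hn.ne', one_smul]

end Topology

end CodimTwo

open CodimTwo

/-! ### The punctured-tube parametrisation `P = tube ∘ cover` -/

namespace FramedTubularEmbedding

variable {n : ℕ} {M : Type} [TopologicalSpace M] [ChartedSpace (𝔼 n) M] [CompactSpace M]
  (E : FramedTubularEmbedding n 2 M)

/-- **The punctured-tube parametrisation** `P = tube ∘ cover : M × ℝ × ℝ → Sⁿ⁺² ∖ M` (its image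
misses the core since the fibre coordinate is nonzero). [folklore] -/
def coverPt (m : M × ℝ × ℝ) : E.embCompl :=
  ⟨E.tube (cover m), E.tube_mem_embCompl _ (cover_snd_ne_zero m)⟩

/-- Value of `coverPt` in `Sⁿ⁺²`. [folklore] -/
@[simp] theorem coe_coverPt (m : M × ℝ × ℝ) : (E.coverPt m : 𝕊 (n + 2)) = E.tube (cover m) := rfl

/-- `coverPt` is smooth. [folklore] -/
theorem contMDiff_coverPt : ContMDiff ((𝓡 n).prod 𝓘(ℝ, ℝ × ℝ)) (𝓡 (n + 2)) ∞ E.coverPt := by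
  rw [← ContMDiff.subtypeVal_comp_iff]
  exact E.contMDiff_tube.comp contMDiff_cover

/-- `coverPt` is continuous. [folklore] -/
theorem continuous_coverPt : Continuous E.coverPt := E.contMDiff_coverPt.continuous

/-- Deck invariance of `coverPt`. [folklore] -/
theorem coverPt_shiftS (m : M × ℝ × ℝ) : E.coverPt (shiftS m) = E.coverPt m :=
  Subtype.ext (by simp only [coe_coverPt, cover_shiftS])

/-- The base point `p₀` is `P (x₀, 0, 0)`. [folklore] -/
theorem coverPt_base (x₀ : M) : E.coverPt (x₀, 0, 0) = E.basePt' x₀ :=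
  Subtype.ext (by rw [coe_coverPt, cover_base]; rfl)

/-- **The meridian is the image of the straight segment `(x₀, 0, 0) ↝ (x₀, 2π, 0)`.** [folklore] -/
theorem meridian_eq_coverPt_segS (x₀ : M) (u : I) :
    E.meridian x₀ u = E.coverPt (segS x₀ u) := by
  apply Subtype.ext
  rw [meridian_apply_coe, coe_coverPt, segS_apply, cover]
  simp

/-- The tube coordinates (inverse of the tube on its range; `M` nonempty). [folklore] -/
def tubeInv [Nonempty M] : 𝕊 (n + 2) → M × 𝔼 2 :=
  haveI : Nonempty (M × 𝔼 2) := inferInstance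
  invFun E.tube

omit [CompactSpace M] in
/-- Tube coordinates of `tube q`. [folklore] -/
@[simp] theorem tubeInv_tube [Nonempty M] (q : M × 𝔼 2) : E.tubeInv (E.tube q) = q :=
  leftInverse_invFun E.injective_tube q

omit [CompactSpace M] in
/-- The tube of the tube coordinates of a point of the range. [folklore] -/
theorem tube_tubeInv [Nonempty M] {p : 𝕊 (n + 2)} (hp : p ∈ range E.tube) : E.tube (E.tubeInv p) = p :=
  invFun_eq hp

omit [CompactSpace M] in
/-- The tube coordinates are smooth on the range of the tube. [folklore] -/
theorem contMDiffOn_tubeInv [Nonempty M] :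
    ContMDiffOn (𝓡 (n + 2)) ((𝓡 n).prod 𝓘(ℝ, 𝔼 2)) ∞ E.tubeInv (range E.tube) := by
  haveI : Nonempty (M × 𝔼 2) := inferInstance
  exact Literature.Geometry.Manifold.contMDiffOn_invFun_range E.isSmoothEmbedding

/-- A point of the complement of the core in the range of the tube has nonzero fibre coordinate.
[folklore] -/
theorem tubeInv_snd_ne_zero [Nonempty M] {z : E.embCompl} (hz : (z : 𝕊 (n + 2)) ∈ range E.tube) :
    (E.tubeInv z).2 ≠ 0 := by
  intro h0
  apply z.2
  refine ⟨(E.tubeInv z).1, ?_⟩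
  rw [emb_apply, ← h0, Prod.mk.eta, E.tube_tubeInv hz]

/-! ### Pushoffs of loops of the core along the framing -/

/-- **The pushoff map** `x ↦ tube (x, e₀)`: the core pushed into the complement along the first
framing vector. [folklore] -/
def pushoffMap : C(M, E.embCompl) :=
  ⟨fun x => ⟨E.tube (x, ((circlePoint 0 : 𝕊 1) : 𝔼 2)),
    E.tube_mem_embCompl x (ne_zero_of_mem_unit_sphere _)⟩,
    (E.continuous_tube.comp (continuous_id.prodMk continuous_const)).subtype_mk _⟩

/-- Value of the pushoff map in `Sⁿ⁺²`. [folklore] -/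
@[simp] theorem coe_pushoffMap (x : M) :
    (E.pushoffMap x : 𝕊 (n + 2)) = E.tube (x, ((circlePoint 0 : 𝕊 1) : 𝔼 2)) := rfl

/-- The pushoff map takes `x₀` to the base point `p₀` (definitional). [folklore] -/
theorem pushoffMap_base (x₀ : M) : E.pushoffMap x₀ = E.basePt' x₀ := rfl

/-- **The pushoff of a loop of the core** along the first framing vector, a loop at `p₀` in the
complement (Kirby 1989, proof of VIII Thm. 3: the parallel copy `N × {pt} ⊂ ∂Y` of `N`).
[cite: Kirby1989, Ch. VIII, proof of Thm. 3 (p. 45)] -/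
def pushoff {x₀ : M} (δ : Path x₀ x₀) : Path (E.basePt' x₀) (E.basePt' x₀) :=
  δ.map E.pushoffMap.continuous

/-- Values of the pushoff. [folklore] -/
@[simp] theorem pushoff_apply {x₀ : M} (δ : Path x₀ x₀) (t : I) :
    E.pushoff δ t = E.pushoffMap (δ t) := rfl

/-- The pushoff of the constant loop is the constant loop. [folklore] -/
theorem pushoff_refl (x₀ : M) : E.pushoff (Path.refl x₀) = Path.refl (E.basePt' x₀) := by
  ext t
  rfl

/-- Homotopic loops have homotopic pushoffs. [folklore] -/
theorem pushoff_homotopic {x₀ : M} {δ δ' : Path x₀ x₀} (h : δ.Homotopic δ') :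
    (E.pushoff δ).Homotopic (E.pushoff δ') :=
  h.map E.pushoffMap

/-! ### Casting paths and homotopies along equalities of end points -/

section Cast

variable {X : Type*} [TopologicalSpace X]

/-- Casting homotopic paths along equal end points gives homotopic paths. [folklore] -/
theorem homotopic_cast {x y x' y' : X} {p q : Path x y} (h : p.Homotopic q) (hx : x' = x)
    (hy : y' = y) : (p.cast hx hy).Homotopic (q.cast hx hy) := by
  subst hx hy
  exact h

/-- The cast of a constant path is the constant path. [folklore] -/
theorem cast_refl {x x' : X} (hx : x' = x) : (Path.refl x).cast hx hx = Path.refl x' := by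
  subst hx
  rfl

end Cast

/-! ### The data of the construction: `φ`, `Θ`, and the lift `H` on the cover -/

/-- **The data of the construction**: the linking homomorphism `φ` with `φ [μ] = 1`, a realising
smooth circle map `Θ` on `Sⁿ⁺² ∖ M` with its angle functions along loops at `p₀` (step 2) and a
continuous lift `H : M × ℝ × ℝ → ℝ` of `Θ ∘ P` along `circlePoint` (step 3). [folklore] -/
structure LiftData (x₀ : M) where
  /-- The linking homomorphism on loops at `p₀`. -/
  φ : FundamentalGroup E.embCompl (E.basePt' x₀) →* Multiplicative ℤ
  /-- The meridian links once. -/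
  φ_meridian : φ (FundamentalGroup.fromPath ⟦E.meridian x₀⟧ₚ) = Multiplicative.ofAdd 1
  /-- The realising circle map. -/
  θ : E.embCompl → 𝕊 1
  /-- It is smooth. -/
  θ_smooth : ContMDiff (𝓡 (n + 2)) (𝓡 1) ∞ θ
  /-- Its winding along loops at `p₀` is `φ`: continuous angle functions exist with increment `φ`. -/
  θ_angle : ∀ γ : Path (E.basePt' x₀) (E.basePt' x₀), ∃ A : I → ℝ, Continuous A ∧
    (∀ t, θ (γ t) = circlePoint (2 * π * A t)) ∧
      A 1 - A 0 = Multiplicative.toAdd (φ (FundamentalGroup.fromPath ⟦γ⟧ₚ))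
  /-- The lift of `Θ ∘ P` to the cover. -/
  H : M × ℝ × ℝ → ℝ
  /-- The lift is continuous. -/
  H_cont : Continuous H
  /-- It lifts. -/
  H_lift : ∀ m, circlePoint (H m) = θ (E.coverPt m)

/-- **The data exist given a linking homomorphism that kills the pushoffs** (for a connected
compact core): Hatcher's Prop. 1B.9 in the tree's smooth form (`exists_contMDiff_circleMap_realising`,
on the path-connected complement) realises `φ` by `Θ`; and `Θ ∘ P` lifts to `ℝ` by the lifting
criterion (Hatcher Prop. 1.33, Mathlib `IsCoveringMap.existsUnique_continuousMap_lifts_of_range_le`):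
a loop `γ` of `M × ℝ × ℝ` at `(x₀, 0, 0)` is homotopic to the product of its first projection `γ₁`
with the constant loop, so `P ∘ γ` is homotopic to the pushoff of `γ₁`, on which `φ` vanishes by
hypothesis; hence the angle function of `Θ` along `P ∘ γ` closes up and `Θ ∘ P ∘ γ`, the image of
a loop of `ℝ`, is null-homotopic. [cite: HatcherAT2002, Prop. 1B.9 and Prop. 1.33] -/
theorem LiftData.nonempty [ConnectedSpace M] (x₀ : M)
    (φ : FundamentalGroup E.embCompl (E.basePt' x₀) →* Multiplicative ℤ)
    (hφm : φ (FundamentalGroup.fromPath ⟦E.meridian x₀⟧ₚ) = Multiplicative.ofAdd 1)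
    (hpush : ∀ δ : Path x₀ x₀, φ (FundamentalGroup.fromPath ⟦E.pushoff δ⟧ₚ) = 1) :
    Nonempty (E.LiftData x₀) := by
  haveI : Nonempty M := ⟨x₀⟩
  haveI : PathConnectedSpace E.embCompl := E.pathConnectedSpace_embCompl
  haveI : LocallyCompactSpace E.embCompl := ChartedSpace.locallyCompactSpace (𝔼 (n + 2)) _
  haveI : SigmaCompactSpace E.embCompl := sigmaCompactSpace_of_locallyCompact_secondCountable
  obtain ⟨θ, hθ, hang⟩ :=
    exists_contMDiff_circleMap_realising (E := 𝔼 (n + 2)) (E.basePt' x₀) φ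
  -- topology of the domain of the cover
  haveI : LocallyPathConnectedSpace M := ChartedSpace.locallyPathConnectedSpace (𝔼 n) M
  haveI : PathConnectedSpace M := pathConnectedSpace_iff_connectedSpace.2 inferInstance
  haveI : LocallyPathConnectedSpace (M × ℝ × ℝ) :=
    .of_bases (fun p ↦ (LocallyPathConnectedSpace.path_connected_basis p.1).prod_nhds
        (LocallyPathConnectedSpace.path_connected_basis p.2))
      fun _ _ hi ↦ hi.1.2.prod hi.2.2
  haveI : SimplyConnectedSpace (ℝ × ℝ) := simplyConnectedSpace_prod
  set f : C(M × ℝ × ℝ, 𝕊 1) :=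
    ⟨fun m => θ (E.coverPt m), hθ.continuous.comp E.continuous_coverPt⟩ with hf
  have hb : E.basePt' x₀ = E.coverPt ((x₀, 0, 0) : M × ℝ × ℝ) := (E.coverPt_base x₀).symm
  -- the lifting criterion: `f` kills `π₁(M × ℝ × ℝ, (x₀, 0, 0))`
  have hkill : ∀ γ : Path ((x₀, 0, 0) : M × ℝ × ℝ) (x₀, 0, 0),
      (γ.map f.continuous).Homotopic (Path.refl _) := by
    intro γ
    -- the loop `P ∘ γ`, based at `p₀`, and its angle function
    set L : Path (E.basePt' x₀) (E.basePt' x₀) := (γ.map E.continuous_coverPt).cast hb hb with hL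
    obtain ⟨A, hA, hθA, hinc⟩ := hang L
    -- `P ∘ γ` is homotopic to the pushoff of the first projection of `γ`
    set γ₁ : Path x₀ x₀ := γ.map continuous_fst with hγ₁
    set γ₂ : Path ((0 : ℝ), (0 : ℝ)) (0, 0) := γ.map continuous_snd with hγ₂
    have hγ : γ = γ₁.prod γ₂ := by
      ext t <;> rfl
    have h2 : γ₂.Homotopic (Path.refl _) := SimplyConnectedSpace.paths_homotopic _ _
    have hq : (⟦γ⟧ₚ : Path.Homotopic.Quotient _ _) = ⟦γ₁.prod (Path.refl ((0 : ℝ), (0 : ℝ)))⟧ₚ := by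
      rw [hγ, ← Path.Homotopic.prod_lift, ← Path.Homotopic.prod_lift, Path.Homotopic.Quotient.eq.2 h2]
    have hγ' : γ.Homotopic (γ₁.prod (Path.refl _)) := Path.Homotopic.Quotient.eq.1 hq
    have hcast : L.Homotopic (((γ₁.prod (Path.refl ((0 : ℝ), (0 : ℝ)))).map
        E.continuous_coverPt).cast hb hb) :=
      homotopic_cast (hγ'.map ⟨_, E.continuous_coverPt⟩) hb hb
    have hpo : ((γ₁.prod (Path.refl ((0 : ℝ), (0 : ℝ)))).map E.continuous_coverPt).cast hb hb =
        E.pushoff γ₁ := by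
      refine Path.ext (funext fun t => Subtype.ext ?_)
      show (E.tube (cover (γ₁ t, (0 : ℝ), (0 : ℝ))) : 𝕊 (n + 2)) =
        E.tube (γ₁ t, ((circlePoint 0 : 𝕊 1) : 𝔼 2))
      rw [cover_base]
    have hφL : φ (FundamentalGroup.fromPath ⟦L⟧ₚ) = 1 := by
      rw [Path.Homotopic.Quotient.eq.2 hcast, hpo]; exact hpush γ₁
    -- hence the angle function closes up
    rw [hφL, toAdd_one, Int.cast_zero, sub_eq_zero] at hinc
    -- `f ∘ γ = circlePoint ∘ (2πA)` is the image of a loop of `ℝ`, hence null-homotopic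
    set ℓ : Path (2 * π * A 0) (2 * π * A 0) :=
      { toFun := fun t => 2 * π * A t
        continuous_toFun := continuous_const.mul hA
        source' := rfl
        target' := by rw [hinc] } with hℓ
    have hℓ : (ℓ.map continuous_circlePoint).Homotopic ((Path.refl _).map continuous_circlePoint) :=
      (SimplyConnectedSpace.paths_homotopic ℓ (Path.refl _)).map ⟨_, continuous_circlePoint⟩
    have h0 : f (x₀, 0, 0) = circlePoint (2 * π * A 0) := by
      have h := hθA 0
      rw [L.source] at h
      show θ (E.coverPt (x₀, 0, 0)) = _
      rw [← hb]
      exact h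
    have hval : ∀ t, (γ.map f.continuous) t = (ℓ.map continuous_circlePoint) t := fun t => by
      show θ (E.coverPt (γ t)) = circlePoint (2 * π * A t)
      rw [← hθA t]
      rfl
    have hmk : (⟦γ.map f.continuous⟧ₚ : Path.Homotopic.Quotient _ _) =
        (⟦ℓ.map continuous_circlePoint⟧ₚ).cast h0 h0 :=
      mk_eq_cast_mk_of_forall_eq _ _ hval h0 h0
    have hrefl : (Path.refl (2 * π * A 0)).map continuous_circlePoint =
        Path.refl (circlePoint (2 * π * A 0)) := by
      ext t
      rfl
    rw [Path.Homotopic.Quotient.eq.2 hℓ, hrefl, ← Path.Homotopic.Quotient.mk_cast, cast_refl h0] at hmk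
    exact Path.Homotopic.Quotient.eq.1 hmk
  -- the lift
  obtain ⟨t₀, ht₀⟩ := circlePoint_surjective (f (x₀, 0, 0))
  obtain ⟨H, ⟨-, hH⟩, -⟩ :=
    isCoveringMap_circlePoint.existsUnique_continuousMap_lifts_of_range_le
      (f := f) (a₀ := ((x₀, 0, 0) : M × ℝ × ℝ)) (e₀ := t₀) ht₀ (by
        rintro _ ⟨g, rfl⟩
        induction g using Quotient.inductionOn with | h γ => ?_
        have h1 : FundamentalGroup.map f (x₀, 0, 0)
            (FundamentalGroup.fromPath (Path.Homotopic.Quotient.mk γ)) = 1 := by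
          change FundamentalGroup.fromPath (Path.Homotopic.Quotient.mk (γ.map f.continuous)) = 1
          rw [Path.Homotopic.Quotient.eq.2 (hkill γ)]
          rfl
        exact h1 ▸ one_mem _)
  exact ⟨⟨φ, hφm, θ, hθ, hang, H, H.continuous, fun m => congrFun hH m⟩⟩

/-- **The data exist for a simply connected core** (`n ≥ 1`): the linking homomorphism of
`CodimTwoLinkingHomomorphism.lean` (`exists_linkingHom`) kills all pushoffs, these being
null-homotopic together with the loops of `M`. [cite: HatcherAT2002, Prop. 1B.9 and Prop. 1.33] -/
theorem LiftData.nonempty_of_simplyConnected [ConnectedSpace M] [SimplyConnectedSpace M]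
    (hn : 1 ≤ n) (x₀ : M) : Nonempty (E.LiftData x₀) := by
  obtain ⟨φ, hmer⟩ := E.exists_linkingHom hn x₀
  refine LiftData.nonempty E x₀ φ hmer fun δ => ?_
  have h : (E.pushoff δ).Homotopic (E.pushoff (Path.refl x₀)) :=
    E.pushoff_homotopic (SimplyConnectedSpace.paths_homotopic _ _)
  rw [Path.Homotopic.Quotient.eq.2 h, pushoff_refl]
  exact map_one φ

namespace LiftData

variable {E} [ConnectedSpace M] {x₀ : M} (L : E.LiftData x₀)

/-- **Increments of the lift along the deck translation are constant**: `H (m⁺) - H m` is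
continuous in `m` with values in `2πℤ`, hence equal to its value at `m = (x₀, 0, 0)`
(`M × ℝ × ℝ` is connected). [folklore] -/
theorem H_shiftS_sub_H (m : M × ℝ × ℝ) :
    L.H (shiftS m) - L.H m = L.H (x₀, 2 * π, 0) - L.H (x₀, 0, 0) := by
  haveI : PreconnectedSpace (M × ℝ × ℝ) := inferInstance
  have hπ : (2 : ℝ) * π ≠ 0 := by positivity
  have hZ : ∀ m, ∃ k : ℤ, (L.H (shiftS m) - L.H m) / (2 * π) = k := fun m => by
    have h : circlePoint (L.H (shiftS m)) = circlePoint (L.H m) := by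
      rw [L.H_lift, L.H_lift, E.coverPt_shiftS]
    obtain ⟨k, hk⟩ := exists_eq_add_of_circlePoint_eq h
    exact ⟨k, by rw [hk]; field_simp; ring⟩
  have hc : Continuous fun m => (L.H (shiftS m) - L.H m) / (2 * π) :=
    ((L.H_cont.comp continuous_shiftS).sub L.H_cont).div_const _
  have h := apply_eq_of_isPreconnected_of_forall_int isPreconnected_univ hc.continuousOn
    (fun m _ => hZ m) (mem_univ m) (mem_univ ((x₀, 0, 0) : M × ℝ × ℝ))
  simp only [shiftS_apply, zero_add] at h
  field_simp at h
  linarith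

omit [ConnectedSpace M] in
/-- **The increment from `(x₀, 0, 0)` to `(x₀, 2π, 0)` is the winding of `Θ` along the meridian
`P ∘ [(x₀, 0, 0), (x₀, 2π, 0)]`**: `t ↦ H(x₀, 2πt, 0)/2π` is a continuous angle function of `Θ` along
that loop, any two continuous angle functions of the same loop have the same increment, and
`φ [μ] = 1`. [folklore] -/
theorem H_sub_H_base : L.H (x₀, 2 * π, 0) - L.H (x₀, 0, 0) = 2 * π := by
  have hπ : (2 : ℝ) * π ≠ 0 := by positivity
  obtain ⟨A, hA, hθA, hinc⟩ := L.θ_angle (E.meridian x₀)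
  rw [L.φ_meridian, toAdd_ofAdd, Int.cast_one] at hinc
  -- `A` and `H ∘ segS / 2π` are both angle functions of `Θ ∘ μ`
  have hZ : ∀ t : I, ∃ k : ℤ, A t - L.H (segS x₀ t) / (2 * π) = k := fun t => by
    have h1 : circlePoint (2 * π * A t) = circlePoint (L.H (segS x₀ t)) := by
      rw [← hθA t, L.H_lift, ← E.meridian_eq_coverPt_segS]
    obtain ⟨k, hk⟩ := exists_eq_add_of_circlePoint_eq h1
    exact ⟨k, by field_simp; linarith [hk]⟩
  have hc : Continuous fun t : I => A t - L.H (segS x₀ t) / (2 * π) :=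
    hA.sub ((L.H_cont.comp (segS x₀).continuous).div_const _)
  have heq := apply_eq_of_isPreconnected_of_forall_int isPreconnected_univ hc.continuousOn
    (fun t _ => hZ t) (mem_univ 1) (mem_univ 0)
  simp only [Path.target, Path.source] at heq
  have h1 : (L.H (x₀, 2 * π, 0) - L.H (x₀, 0, 0)) / (2 * π) = 1 := by
    rw [sub_div]; linarith
  rw [div_eq_iff hπ, one_mul] at h1
  exact h1

/-- **The lift gains `2π` under the deck translation.** [folklore] -/
theorem H_shiftS (m : M × ℝ × ℝ) : L.H (shiftS m) = L.H m + 2 * π := by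
  have h := L.H_shiftS_sub_H m
  rw [L.H_sub_H_base] at h
  linarith

omit [ConnectedSpace M] in
/-- **The lift is smooth** (a continuous lift of a smooth circle map along the local
diffeomorphism `circlePoint`: near `m₀`, `H = A ∘ Θ ∘ P + const` for an angle function `A` of
`𝕊¹` smooth at `Θ (P m₀)`). [folklore] -/
theorem contMDiff_H : ContMDiff ((𝓡 n).prod 𝓘(ℝ, ℝ × ℝ)) 𝓘(ℝ, ℝ) ∞ L.H := by
  intro m₀
  have hπ : (2 : ℝ) * π ≠ 0 := by positivity
  obtain ⟨A, hA, hAs⟩ := exists_angle_contMDiffAt (L.θ (E.coverPt m₀))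
  have hZ : ∀ m, ∃ k : ℤ, (L.H m - A (L.θ (E.coverPt m))) / (2 * π) = k := fun m => by
    have h : circlePoint (L.H m) = circlePoint (A (L.θ (E.coverPt m))) := by rw [L.H_lift, hAs]
    obtain ⟨k, hk⟩ := exists_eq_add_of_circlePoint_eq h
    exact ⟨k, by rw [hk]; field_simp; ring⟩
  have hcomp : ContMDiffAt ((𝓡 n).prod 𝓘(ℝ, ℝ × ℝ)) 𝓘(ℝ, ℝ) ∞
      (fun m => A (L.θ (E.coverPt m))) m₀ :=
    hA.comp m₀ (L.θ_smooth.contMDiffAt.comp m₀ E.contMDiff_coverPt.contMDiffAt)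
  have hcont : ContinuousAt (fun m => (L.H m - A (L.θ (E.coverPt m))) / (2 * π)) m₀ :=
    (L.H_cont.continuousAt.sub hcomp.continuousAt).div_const _
  have hev : L.H =ᶠ[𝓝 m₀] fun m => A (L.θ (E.coverPt m)) + (L.H m₀ - A (L.θ (E.coverPt m₀))) := by
    filter_upwards [eventuallyEq_of_continuousAt_of_forall_int hcont hZ] with m hm
    rw [div_eq_div_iff hπ hπ] at hm
    have : (L.H m - A (L.θ (E.coverPt m))) = (L.H m₀ - A (L.θ (E.coverPt m₀))) := by
      have := mul_right_cancel₀ hπ hm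
      linarith
    linarith
  refine ContMDiffAt.congr_of_eventuallyEq ?_ hev
  exact hcomp.add contMDiffAt_const

/-- **The gauge function** `G = (H - s)/2π` on the cover. [folklore] -/
def G (m : M × ℝ × ℝ) : ℝ := (L.H m - m.2.1) / (2 * π)

omit [ConnectedSpace M] in
/-- `G` is smooth. [folklore] -/
theorem contMDiff_G : ContMDiff ((𝓡 n).prod 𝓘(ℝ, ℝ × ℝ)) 𝓘(ℝ, ℝ) ∞ L.G := by
  have hs : ContMDiff ((𝓡 n).prod 𝓘(ℝ, ℝ × ℝ)) 𝓘(ℝ, ℝ) ∞ fun m : M × ℝ × ℝ => m.2.1 :=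
    (contDiff_fst : ContDiff ℝ ∞ fun v : ℝ × ℝ => v.1).contMDiff.comp contMDiff_snd
  exact ((contDiff_id.div_const (2 * π)).contMDiff (n := ∞)).comp (L.contMDiff_H.sub hs)

/-- `G` is invariant under the deck translation. [folklore] -/
theorem G_shiftS (m : M × ℝ × ℝ) : L.G (shiftS m) = L.G m := by
  simp only [G, L.H_shiftS]
  obtain ⟨x, s, r⟩ := m
  simp only [shiftS_apply]
  ring

/-- `G` is invariant under all integer deck translations. [folklore] -/
theorem G_add_int (x : M) (s r : ℝ) (l : ℤ) : L.G (x, s + l * (2 * π), r) = L.G (x, s, r) := by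
  have hper : Function.Periodic (fun s => L.G (x, s, r)) (2 * π) := fun s => L.G_shiftS (x, s, r)
  exact hper.int_mul l s

/-- **`G` is constant on the fibres of the cover**, hence descends. [folklore] -/
theorem G_eq_of_cover_eq {m m' : M × ℝ × ℝ} (h : cover m = cover m') : L.G m = L.G m' := by
  obtain ⟨l, h1, h2, h3⟩ := exists_int_of_cover_eq h
  obtain ⟨x, s, r⟩ := m
  obtain ⟨x', s', r'⟩ := m'
  simp only at h1 h2 h3
  subst h1 h2 h3
  rw [L.G_add_int]

end LiftData

/-! ### The cut-off and the descended gauge function -/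

section CutOff

variable [Nonempty M]

open Classical in
/-- **The cut-off** `χ = s(3 - 2‖w‖)` in tube coordinates (`1` on the closed unit tube, `0`
off the tube of radius `3/2`), extended by `0` off the tube. [folklore] -/
def chi (z : E.embCompl) : ℝ :=
  if (z : 𝕊 (n + 2)) ∈ range E.tube then
    Real.smoothTransition (3 - 2 * ‖(E.tubeInv z).2‖) else 0

/-- The cut-off in tube coordinates. [folklore] -/
theorem chi_apply (x : M) {w : 𝔼 2} (hw : w ≠ 0) :
    E.chi ⟨E.tube (x, w), E.tube_mem_embCompl x hw⟩ = Real.smoothTransition (3 - 2 * ‖w‖) := by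
  simp only [chi]
  rw [if_pos (mem_range_self _), tubeInv_tube]

/-- The cut-off is `1` on the closed unit tube. [folklore] -/
theorem chi_eq_one (x : M) {w : 𝔼 2} (hw : w ≠ 0) (h1 : ‖w‖ ≤ 1) :
    E.chi ⟨E.tube (x, w), E.tube_mem_embCompl x hw⟩ = 1 := by
  rw [E.chi_apply x hw]
  exact Real.smoothTransition.one_of_one_le (by linarith)

/-- **Off the closed tube of radius `3/2` the cut-off vanishes.** [folklore] -/
theorem chi_eq_zero_of_not_mem {z : E.embCompl}
    (hz : (z : 𝕊 (n + 2)) ∉ E.closedTubeSet (3 / 2)) : E.chi z = 0 := by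
  simp only [chi]
  split_ifs with h
  · obtain ⟨⟨x, w⟩, hxw⟩ := h
    have hw : 3 / 2 < ‖w‖ := by
      by_contra hle
      exact hz ⟨(x, w), ⟨mem_univ _, by simpa using not_lt.1 hle⟩, hxw⟩
    have : (E.tubeInv z).2 = w := by rw [← hxw, tubeInv_tube]
    rw [this]
    exact Real.smoothTransition.zero_of_nonpos (by linarith)
  · rfl

/-- **The cut-off is smooth at points of the tube** (there `w ≠ 0`, so the norm is smooth).
[folklore] -/
theorem contMDiffAt_chi {z : E.embCompl} (hz : (z : 𝕊 (n + 2)) ∈ range E.tube) :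
    ContMDiffAt (𝓡 (n + 2)) 𝓘(ℝ, ℝ) ∞ E.chi z := by
  have hev : E.chi =ᶠ[𝓝 z] fun z' => Real.smoothTransition (3 - 2 * ‖(E.tubeInv z').2‖) := by
    filter_upwards [(E.isOpen_range.preimage continuous_subtype_val).mem_nhds hz] with z' hz'
    simp only [chi]
    rw [if_pos (show (z' : 𝕊 (n + 2)) ∈ range E.tube from hz')]
  refine ContMDiffAt.congr_of_eventuallyEq ?_ hev
  have hsymm : ContMDiffAt (𝓡 (n + 2)) ((𝓡 n).prod 𝓘(ℝ, 𝔼 2)) ∞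
      (fun z' : E.embCompl => E.tubeInv z') z :=
    (E.contMDiffOn_tubeInv.contMDiffAt (E.isOpen_range.mem_nhds hz)).comp z
      contMDiff_subtype_val.contMDiffAt
  have hsnd := contMDiffAt_snd.comp z hsymm
  have hg : ContDiffAt ℝ ∞ (fun w : 𝔼 2 => Real.smoothTransition (3 - 2 * ‖w‖)) (E.tubeInv z).2 :=
    Real.smoothTransition.contDiff.contDiffAt.comp _
      (contDiffAt_const.sub (contDiffAt_const.mul (contDiffAt_norm ℝ (E.tubeInv_snd_ne_zero hz))))
  exact hg.comp_contMDiffAt (x := z)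
    (f := fun z' : E.embCompl => (E.tubeInv (z' : 𝕊 (n + 2))).2) hsnd

end CutOff

namespace LiftData

variable {E} [ConnectedSpace M] {x₀ : M} (L : E.LiftData x₀)

/-- **The descended gauge function** `g` on the complement of the core: `G` evaluated at the
global section of the tube coordinates (meaningful on the punctured tube). [folklore] -/
def gfun (z : E.embCompl) : ℝ :=
  haveI : Nonempty M := ⟨x₀⟩
  L.G (sec₀ (E.tubeInv z))

/-- **`g ∘ P = G`**: the gauge function descends. [folklore] -/
theorem gfun_coverPt (m : M × ℝ × ℝ) : L.gfun (E.coverPt m) = L.G m := by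
  haveI : Nonempty M := ⟨x₀⟩
  unfold gfun
  refine L.G_eq_of_cover_eq ?_
  rw [coe_coverPt, tubeInv_tube]
  rcases hc : cover m with ⟨x, w⟩
  have hw : w ≠ 0 := by
    have := cover_snd_ne_zero m
    rwa [hc] at this
  exact cover_sec₀ x hw

/-- **Any section computes `g`** on the punctured tube. [folklore] -/
theorem gfun_eq_of_section {sc : M × 𝔼 2 → M × ℝ × ℝ}
    (hsc : ∀ (x : M) (w : 𝔼 2), w ≠ 0 → cover (sc (x, w)) = (x, w)) {z : E.embCompl}
    (hz : (z : 𝕊 (n + 2)) ∈ range E.tube) :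
    haveI : Nonempty M := ⟨x₀⟩
    L.gfun z = L.G (sc (E.tubeInv z)) := by
  haveI : Nonempty M := ⟨x₀⟩
  unfold gfun
  refine L.G_eq_of_cover_eq ?_
  have hw := E.tubeInv_snd_ne_zero hz
  rcases hc : E.tubeInv z with ⟨x, w⟩
  rw [hc] at hw
  rw [cover_sec₀ x hw, hsc x w hw]

/-- **`g` is smooth on the punctured tube** (locally `G ∘ sc ∘ tube⁻¹` for a smooth local section
`sc`). [folklore] -/
theorem contMDiffAt_gfun {z : E.embCompl} (hz : (z : 𝕊 (n + 2)) ∈ range E.tube) :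
    ContMDiffAt (𝓡 (n + 2)) 𝓘(ℝ, ℝ) ∞ L.gfun z := by
  haveI : Nonempty M := ⟨x₀⟩
  have hw₀ := E.tubeInv_snd_ne_zero hz
  obtain ⟨sc, hsc, hscs⟩ := exists_localSection (n := n) (E.tubeInv z).1 hw₀
  have hev : L.gfun =ᶠ[𝓝 z] fun z' => L.G (sc (E.tubeInv z')) := by
    filter_upwards [(E.isOpen_range.preimage continuous_subtype_val).mem_nhds hz] with z' hz'
    exact L.gfun_eq_of_section hscs hz'
  refine ContMDiffAt.congr_of_eventuallyEq ?_ hev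
  have hsymm : ContMDiffAt (𝓡 (n + 2)) ((𝓡 n).prod 𝓘(ℝ, 𝔼 2)) ∞
      (fun z' : E.embCompl => E.tubeInv z') z :=
    (E.contMDiffOn_tubeInv.contMDiffAt (E.isOpen_range.mem_nhds hz)).comp z
      contMDiff_subtype_val.contMDiffAt
  exact L.contMDiff_G.contMDiffAt.comp z (hsc.comp z hsymm)

/-- **The correction term** `χ · g`. [folklore] -/
def corr (z : E.embCompl) : ℝ :=
  haveI : Nonempty M := ⟨x₀⟩
  E.chi z * L.gfun z

/-- **The correction term is smooth** on the whole complement: on the tube both factors are,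
and off the closed tube of radius `3/2` it vanishes identically. [folklore] -/
theorem contMDiff_corr : ContMDiff (𝓡 (n + 2)) 𝓘(ℝ, ℝ) ∞ L.corr := fun z => by
  haveI : Nonempty M := ⟨x₀⟩
  by_cases hz : (z : 𝕊 (n + 2)) ∈ range E.tube
  · exact (E.contMDiffAt_chi hz).mul (L.contMDiffAt_gfun hz)
  · have hzC : (z : 𝕊 (n + 2)) ∉ E.closedTubeSet (3 / 2) :=
      fun h => hz (E.closedTubeSet_subset_range _ h)
    have hev : L.corr =ᶠ[𝓝 z] fun _ => 0 := by
      filter_upwards [((E.isClosed_closedTubeSet (3 / 2)).isOpen_compl.preimage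
        continuous_subtype_val).mem_nhds hzC] with z' hz'
      simp only [corr, E.chi_eq_zero_of_not_mem hz', zero_mul]
    exact contMDiffAt_const.congr_of_eventuallyEq hev

/-! ### Step 4: the circle map `θ = e^{i(arg Θ - 2πχg)}` -/

/-- A fixed global angle function of the circle (a right inverse of `circlePoint`; not
continuous): the tree's `Knot.TubularNbhd.angle₀`. [folklore] -/
abbrev angle₀ : (𝕊 1) → ℝ := Knot.TubularNbhd.angle₀

omit [ConnectedSpace M] in
/-- **The exponential of an angle of a smooth circle map, shifted by a smooth function, is a
smooth circle map**: `z ↦ e^{i(angle₀ (Θ z) - c z)}` (independent of the chosen angle, so near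
each point a smooth local angle can be used). [folklore] -/
theorem contMDiffAt_circlePoint_angle_sub {Θ : E.embCompl → 𝕊 1} {c : E.embCompl → ℝ}
    {z : E.embCompl} (hΘ : ContMDiffAt (𝓡 (n + 2)) (𝓡 1) ∞ Θ z)
    (hc : ContMDiffAt (𝓡 (n + 2)) 𝓘(ℝ, ℝ) ∞ c z) :
    ContMDiffAt (𝓡 (n + 2)) (𝓡 1) ∞ (fun z' => circlePoint (angle₀ (Θ z') - c z')) z := by
  obtain ⟨A, hA, hAs⟩ := exists_angle_contMDiffAt (Θ z)
  have hev : (fun z' => circlePoint (angle₀ (Θ z') - c z')) =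
      fun z' => circlePoint (A (Θ z') - c z') := by
    funext z'
    obtain ⟨k, hk⟩ := exists_eq_add_of_circlePoint_eq
      (show circlePoint (angle₀ (Θ z')) = circlePoint (A (Θ z')) by
        rw [Knot.TubularNbhd.circlePoint_angle₀, hAs])
    rw [hk, show A (Θ z') + k * (2 * π) - c z' = (A (Θ z') - c z') + k * (2 * π) by ring]
    exact periodic_circlePoint.int_mul k _
  rw [hev]
  exact contMDiff_circlePoint.contMDiffAt.comp z ((hA.comp z hΘ).sub hc)

/-- **The circle-valued map** `θ = e^{i(arg Θ - 2πχg)}` of the complement of the core. [folklore] -/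
def theta (z : E.embCompl) : 𝕊 1 := circlePoint (angle₀ (L.θ z) - 2 * π * L.corr z)

/-- `θ` is smooth. [folklore] -/
theorem contMDiff_theta : ContMDiff (𝓡 (n + 2)) (𝓡 1) ∞ L.theta := fun z =>
  contMDiffAt_circlePoint_angle_sub (L.θ_smooth z)
    (((contDiff_const (c := 2 * π)).mul contDiff_id).contDiffAt.comp_contMDiffAt
      (L.contMDiff_corr z))

/-- **On the punctured closed unit tube `θ` is the fibre angle** `w/‖w‖`: there `χ = 1`, and
for `m` over `tube (x, w)`, `arg Θ - 2πg ≡ H(m) - (H(m) - s) = s (mod 2π)` with `e^{is} = w/‖w‖`.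
[folklore] -/
theorem coe_theta_apply (x : M) {w : 𝔼 2} (hw : w ≠ 0) (h1 : ‖w‖ ≤ 1) :
    ((L.theta ⟨E.tube (x, w), E.tube_mem_embCompl x hw⟩ : 𝕊 1) : 𝔼 2) = ‖w‖⁻¹ • w := by
  haveI : Nonempty M := ⟨x₀⟩
  set z : E.embCompl := ⟨E.tube (x, w), E.tube_mem_embCompl x hw⟩ with hz
  set m : M × ℝ × ℝ := sec₀ (x, w) with hm
  have hPm : E.coverPt m = z := Subtype.ext (by rw [coe_coverPt, hm, cover_sec₀ x hw])
  have hcorr : L.corr z = L.G m := by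
    show E.chi z * L.gfun z = L.G m
    rw [hz, E.chi_eq_one x hw h1, one_mul, ← hz, ← hPm, L.gfun_coverPt]
  obtain ⟨k, hk⟩ := exists_eq_add_of_circlePoint_eq
    (show circlePoint (angle₀ (L.θ z)) = circlePoint (L.H m) by
      rw [Knot.TubularNbhd.circlePoint_angle₀, L.H_lift, hPm])
  have harg : angle₀ (L.θ z) - 2 * π * L.G m = m.2.1 + k * (2 * π) := by
    simp only [G]
    have hπ : (2 : ℝ) * π ≠ 0 := by positivity
    field_simp
    rw [hk]
    ring
  rw [theta, hcorr, harg, periodic_circlePoint.int_mul k, hm]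
  exact coe_circlePoint_argE hw

end LiftData

/-! ### The circle-valued map and the Seifert hypersurface datum -/

/-- **The circle-valued map of the complement, from a linking homomorphism killing the
pushoffs** (Kirby 1989, proof of VIII Thm. 3: "`f_α : Q − N → S¹` with `f_α = pν` on `∂Y`", for
`Q = Sⁿ⁺²`): for a connected compact `M` with a framed tubular embedding `E` into `Sⁿ⁺²`, a base
point `x₀` and a homomorphism `φ : π₁(Sⁿ⁺² ∖ M, p₀) → ℤ` with `φ [meridian] = 1` vanishing on the
pushoffs of all loops of `M` at `x₀`, there is a `C^∞` map `θ : Sⁿ⁺² ∖ M → 𝕊¹` with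
`θ (tube (x, w)) = w/‖w‖` for `0 < ‖w‖ ≤ 1`. [cite: Kirby1989, Ch. VIII, proof of Thm. 3 (p. 45)] -/
theorem exists_circleMap_eq_angle_of_linkingHom [ConnectedSpace M] (x₀ : M)
    (φ : FundamentalGroup E.embCompl (E.basePt' x₀) →* Multiplicative ℤ)
    (hφm : φ (FundamentalGroup.fromPath ⟦E.meridian x₀⟧ₚ) = Multiplicative.ofAdd 1)
    (hpush : ∀ δ : Path x₀ x₀, φ (FundamentalGroup.fromPath ⟦E.pushoff δ⟧ₚ) = 1) :
    ∃ θ : E.embCompl → 𝕊 1, ContMDiff (𝓡 (n + 2)) (𝓡 1) ∞ θ ∧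
      ∀ (x : M) (w : 𝔼 2) (hw : w ≠ 0), ‖w‖ ≤ 1 →
        ((θ ⟨E.tube (x, w), E.tube_mem_embCompl x hw⟩ : 𝕊 1) : 𝔼 2) = ‖w‖⁻¹ • w := by
  obtain ⟨L⟩ := LiftData.nonempty E x₀ φ hφm hpush
  exact ⟨L.theta, L.contMDiff_theta, fun x w hw h1 => L.coe_theta_apply x hw h1⟩

/-- **Seifert hypersurface data from a linking homomorphism killing the pushoffs** (connected
compact core): the circle-valued map of `exists_circleMap_eq_angle_of_linkingHom` together with a
regular value `v = circlePt t` whose antipode `circlePt (t + 1/2) = -v` is regular too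
(`exists_circlePt_isRegularValue_and_antipode`, Brown–Sard, with the tree's `sard_holds`).
[cite: Kirby1989, Ch. VIII, proof of Thm. 3 (p. 45)] -/
theorem nonempty_seifertHypersurfaceDatum_of_linkingHom [ConnectedSpace M] (x₀ : M)
    (φ : FundamentalGroup E.embCompl (E.basePt' x₀) →* Multiplicative ℤ)
    (hφm : φ (FundamentalGroup.fromPath ⟦E.meridian x₀⟧ₚ) = Multiplicative.ofAdd 1)
    (hpush : ∀ δ : Path x₀ x₀, φ (FundamentalGroup.fromPath ⟦E.pushoff δ⟧ₚ) = 1) :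
    Nonempty (SeifertHypersurfaceDatum E) := by
  obtain ⟨θ, hθs, hang⟩ := E.exists_circleMap_eq_angle_of_linkingHom x₀ φ hφm hpush
  obtain ⟨t, h1, h2⟩ := exists_circlePt_isRegularValue_and_antipode
    Literature.Analysis.Calculus.sard_holds hθs
  refine ⟨⟨θ, circlePt t, hθs, hang, fun p hp => h1 p (Subtype.ext hp),
    fun p hp => h2 p (Subtype.ext ?_)⟩⟩
  rw [hp, coe_circlePt_add_half]

/-- **The circle-valued map of the complement of a framed codimension-two submanifold with simply
connected core** (Kirby 1989, proof of VIII Thm. 3, for `Q = Sⁿ⁺²`, `n ≥ 1`): for a connected,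
simply connected compact `M` with a framed tubular embedding `E` into `Sⁿ⁺²` there is a `C^∞` map
`θ : Sⁿ⁺² ∖ M → 𝕊¹` with `θ (tube (x, w)) = w/‖w‖` for `0 < ‖w‖ ≤ 1` — the linking homomorphism
(`exists_linkingHom`) realised by a smooth circle map, corrected on the tube via the cover of the
punctured tube. [cite: Kirby1989, Ch. VIII, proof of Thm. 3 (p. 45)] -/
theorem exists_circleMap_eq_angle [ConnectedSpace M] [SimplyConnectedSpace M] (hn : 1 ≤ n) :
    ∃ θ : E.embCompl → 𝕊 1, ContMDiff (𝓡 (n + 2)) (𝓡 1) ∞ θ ∧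
      ∀ (x : M) (w : 𝔼 2) (hw : w ≠ 0), ‖w‖ ≤ 1 →
        ((θ ⟨E.tube (x, w), E.tube_mem_embCompl x hw⟩ : 𝕊 1) : 𝔼 2) = ‖w‖⁻¹ • w := by
  obtain ⟨x₀⟩ := (inferInstance : Nonempty M)
  obtain ⟨L⟩ := LiftData.nonempty_of_simplyConnected E hn x₀
  exact ⟨L.theta, L.contMDiff_theta, fun x w hw h1 => L.coe_theta_apply x hw h1⟩

/-- **Seifert hypersurface data exist** (the analytic half of Kirby's VIII Thm. 3 for
`Q = Sⁿ⁺²`, `n ≥ 1`, simply connected connected compact core): the circle-valued map of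
`exists_circleMap_eq_angle` together with a regular value `v = circlePt t` whose antipode
`circlePt (t + 1/2) = -v` is regular too (`exists_circlePt_isRegularValue_and_antipode`, Brown–Sard,
with the tree's `sard_holds`). [cite: Kirby1989, Ch. VIII, proof of Thm. 3 (p. 45)] -/
theorem nonempty_seifertHypersurfaceDatum [ConnectedSpace M] [SimplyConnectedSpace M] (hn : 1 ≤ n) :
    Nonempty (SeifertHypersurfaceDatum E) := by
  obtain ⟨θ, hθs, hang⟩ := E.exists_circleMap_eq_angle hn
  obtain ⟨t, h1, h2⟩ := exists_circlePt_isRegularValue_and_antipode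
    Literature.Analysis.Calculus.sard_holds hθs
  refine ⟨⟨θ, circlePt t, hθs, hang, fun p hp => h1 p (Subtype.ext hp),
    fun p hp => h2 p (Subtype.ext ?_)⟩⟩
  rw [hp, coe_circlePt_add_half]

end FramedTubularEmbedding

end Literature.Topology.FourManifolds
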